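import Summits.Ventures.HSemireg.WedgeWeilPurityStructure

/-!
# Venture HSemireg — W-PURITY in Schur form (1/2): strip maps

HONEST FRAMING. Part of the Lean index of the computation cell `pub-hsemireg` (second enclosure wave, cut by seat p6 in the
conventions of seat p3's ENCLOSURE-PLAN-p3.md / build.py from th-7's kernel assets).  Finite-dimensional exterior algebra over a field ONLY:
no variety, no cohomology theory, no semiregularity map is constructed here; nothing here says that HC / HC_CM / HC_AV holds;
no Literature fact is declared or used.  The geometric DICTIONARY (why these ranks are the `HT`-side box ranks of the cell's
STRUCTURE.md §1 / theory/FORMULA-N.md) lives in theory/FORMULA-N-th7.md PART B §A.3 / §N and is NOT asserted in Lean.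

th-7's PART S2 — THE SCHUR FORM OF THE ENDS BLOCK (theory/th7/WPurityStructure.lean, PART S2 (text byte-identical in v2 a1636d8e15c55ff0 / v3 ae498f7d4ae161bb; th-7 g7, 2026-08-23; ×2 farm + NC-S2 at p6 g7), the block after PART S's `end Purity`), VERBATIM up to the
namespace (`HSemiregWeil` ↦ `Summit.Ventures.HSemireg.Wedge.Weil`), file 1 of 2.  At Weil type `(n,n)`, degree `n ≥ 1`: strip maps `σ_D` (left inverse of `· ∧ E_D`),
`ψ₊ := σ_{Gm}∘(∧f) : E₊ → E₋` and `ψ₋ := σ_{Dm}∘(∧f) : E₋ → E₊` with `θ₊∧f = ψ₊θ₊ ∧ w₊`, `θ₋∧f = ψ₋θ₋ ∧ w₋`, each of rank `ρ = rank H_n(q)` on the ends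
(`finrank_map_psiP` / `finrank_map_psiM`); ends expansion with the two summands independent; **`ends_ker_eq`** (`a ≠ 0`): `Ends ⊓ ker(∧v) = J(E₊ ⊓ ker(ψ₋ψ₊ − ab·id))`,
`J = id − a⁻¹ψ₊` injective on `E₊`; and **`weilPurity_schur (hn : 1 ≤ n) (q) (ha : a ≠ 0) (b)`**: `finrank range(∧v ∣ ⋀ⁿ) + 2ρ + dim(E₊ ⊓ ker(ψ₋ψ₊ − ab))
= C(2n,n)·ρ + 2·C(2n,n)`, i.e. rank = `C(2n,n)(2+ρ) − 2ρ − dim ker(ψ₋ψ₊ − ab ∣ E₊)` for EVERY `q`, `b`, field — the SHAPE of W-PURITY(ρ) in the kernel; the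
only remaining non-kernel content is the identification of `ψ₋ψ₊ ∣ E₊` with `S(q) = (−1)ⁿ(H_n(q)Ω_n)²` (derived ×2, numerics ×2 codes n ≤ 6).  This file: section Schur (general signature `(p, N−p)`): the strip maps and their basic identities.
-/

open Module Set Set.powersetCard Summit.Ventures.HSemireg.Wedge.Hankel

namespace Summit.Ventures.HSemireg.Wedge.Weil

variable (K : Type*) [Field K]

/-! ## PART S2 (th-7 g7, 2026-08-23) — THE SCHUR FORM OF THE ENDS BLOCK (FORMULA-N PART B §L.5, Step 4 up to the compression)
At the purity degree (Weil type (n,n), m = n ≥ 1), with `E₋ = Λⁿ V₋ = Hom(Dm) n`, `E₊ = Λⁿ V₊ = Hom(Gm) n`,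
`w₊ = E_{Gm}`, `w₋ = E_{Dm}`: the STRIP maps `σ_D` (inverse of `· ∧ E_D` on its image) define
`ψ₊ := σ_{Gm} ∘ (· ∧ f) : E₊ → E₋`, `ψ₋ := σ_{Dm} ∘ (· ∧ f) : E₋ → E₊` (each of rank ρ = rank H_n(q)) with
`θ₊ ∧ f = ψ₊(θ₊) ∧ w₊`, `θ₋ ∧ f = ψ₋(θ₋) ∧ w₋`; for `θ = θ₋ + θ₊ ∈ Ends`:
`θ ∧ v = (ψ₋θ₋ + b·θ₊) ∧ w₋ + (a·θ₋ + ψ₊θ₊) ∧ w₊`, the two summands independent; hence for `a ≠ 0`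
`ker(∧v ∣ Ends) ≅ ker(ψ₋ψ₊ − ab ∣ E₊)` (`ends_ker_eq`, `finrank_ends_ker`) and
**`weilPurity_schur`: rank(∧v ∣ HTⁿ) = C(2n,n)·(2 + ρ) − 2ρ − dim ker(ψ₋ψ₊ − ab ∣ E₊)** (additive form) —
W-PURITY(ρ) with the conjectured `S(q)` replaced by the EXPLICIT operator `ψ₋ψ₊` on `E₊` (rank ≤ ρ). What remains
non-kernel: the identification of the non-zero spectrum of `ψ₋ψ₊` with that of `κ_n(Ω′⁻¹H_n(q))²` (Flanders + Schur). -/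

section Schur

variable {N : ℕ}

/-- conjunction of support predicates. -/
lemma mem_Sp_and {P Q : Finset (In N) → Prop} {v : HT K (In N)} (hP : v ∈ Sp K P) (hQ : v ∈ Sp K Q) :
    v ∈ Sp K (fun s => P s ∧ Q s) := by
  rw [mem_Sp_iff] at hP hQ ⊢
  exact fun t ht => ⟨hP t ht, hQ t ht⟩

/-- `dim Hom(D, d) = C(|D|, d)`. -/
lemma finrank_Hom_eq (D : Finset (In N)) (d : ℕ) :
    Module.finrank K ↥(Hom K (In N) D d) = D.card.choose d := by
  classical
  rw [Hom_eq_Sp, finrank_Sp]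
  have h : Finset.univ.filter (fun s : Finset (In N) => s ⊆ D ∧ s.card = d) = D.powersetCard d := by
    ext s
    simp [Finset.mem_powersetCard]
  rw [h, Finset.card_powersetCard]

/-- the STRIP map `σ_D`: `E_r ↦ u(r ∖ D, D)⁻¹ • E_{r ∖ D}` if `D ⊆ r`, else `0` — a left inverse of `x ↦ x ∧ E_D`
on `Sp{D ⊆ r}`. -/
noncomputable def strip (D : Finset (In N)) : HT K (In N) →ₗ[K] HT K (In N) :=
  (B K (In N)).constr K fun r => if D ⊆ r then (u K (r \ D) D)⁻¹ • B K (In N) (r \ D) else 0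

/-- the strip map on a basis monomial: `σ_D(E_r) = u(r ∖ D, D)⁻¹ • E_{r ∖ D}` if `D ⊆ r`, else `0`. -/
lemma strip_B (D r : Finset (In N)) :
    strip K D (B K (In N) r) = if D ⊆ r then (u K (r \ D) D)⁻¹ • B K (In N) (r \ D) else 0 := by
  rw [strip, Basis.constr_basis]

/-- `σ_D(x) ∧ E_D = x` for `x ∈ Sp{D ⊆ r}`. -/
lemma strip_mul_B {D : Finset (In N)} {x : HT K (In N)} (hx : x ∈ Sp K (fun r => D ⊆ r)) :
    strip K D x * B K (In N) D = x := by
  induction hx using Submodule.span_induction with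
  | mem y hy =>
    obtain ⟨r, hr, rfl⟩ := hy
    have hd : Disjoint (r \ D) D := Finset.sdiff_disjoint
    have hu : u K (r \ D) D ≠ 0 := (u_ne_zero_iff K).mpr hd
    have hr' : D ⊆ r := hr
    rw [strip_B, if_pos hr', smul_mul_assoc, B_mul_B, smul_smul, inv_mul_cancel₀ hu, one_smul,
      Finset.sdiff_union_of_subset hr']
  | zero => rw [map_zero, zero_mul]
  | add y z _ _ hy hz => rw [map_add, add_mul, hy, hz]
  | smul c y _ hy => rw [map_smul, smul_mul_assoc, hy]

/-- `σ_D` is injective on `Sp{D ⊆ r}`. -/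
lemma strip_eq_zero {D : Finset (In N)} {x : HT K (In N)} (hx : x ∈ Sp K (fun r => D ⊆ r))
    (h : strip K D x = 0) : x = 0 := by
  rw [← strip_mul_B K hx, h, zero_mul]

/-- `σ_D` maps `Sp{D ⊆ r, |r| = d + |D|}` into the degree-`d` monomials on `Dᶜ`. -/
lemma strip_mem_Hom {D : Finset (In N)} {d : ℕ} {x : HT K (In N)}
    (hx : x ∈ Sp K (fun r => D ⊆ r ∧ r.card = d + D.card)) : strip K D x ∈ Hom K (In N) Dᶜ d := by
  induction hx using Submodule.span_induction with
  | mem y hy =>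
    obtain ⟨r, ⟨hr, hc⟩, rfl⟩ := hy
    have hr' : D ⊆ r := hr
    rw [strip_B, if_pos hr']
    refine Submodule.smul_mem _ _ (B_mem_Hom K ?_ ?_)
    · intro i hi
      rw [Finset.mem_compl]
      exact (Finset.mem_sdiff.mp hi).2
    · have h1 := Finset.card_sdiff_add_card_eq_card hr'
      omega
  | zero => rw [map_zero]; exact Submodule.zero_mem _
  | add y z _ _ hy hz => rw [map_add]; exact Submodule.add_mem _ hy hz
  | smul c y _ hy => rw [map_smul]; exact Submodule.smul_mem _ _ hy

/-- `f = w_N(q)` is transversal with `μ = N − p` AND of degree `N`. -/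
lemma f_mem_Sp_card (p : ℕ) (q : ℕ → K) :
    w K N N q ∈ Sp K (fun t => Fsupp (N := N) p t ∧ t.card = N) := by
  have h2 : w K N N q ∈ Sp K (fun t => t ⊆ Dm N N ∧ t.card = N) := by
    rw [← Hom_eq_Sp]; exact w_mem_Hom K le_rfl q
  exact Sp_mono (fun t ht => ⟨ht.1, ht.2.2⟩) (mem_Sp_and K (f_mem_Sp K p q) h2)

/-- a set meeting `Gm` in all of `Gm`'s cardinality contains `Gm`. -/
lemma Gm_subset_of_μ {p : ℕ} {r : Finset (In N)} (h : μ p r = (Gm N p).card) : Gm N p ⊆ r := by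
  have : r ∩ Gm N p = Gm N p :=
    Finset.eq_of_subset_of_card_le Finset.inter_subset_right (by unfold μ at h; rw [h])
  exact Finset.inter_eq_right.mp this

end Schur

end Summit.Ventures.HSemireg.Wedge.Weil
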